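import Literature.Analysis.FluidPDE.MillerStrainDeterminantBound
import Literature.Analysis.FluidPDE.TorusStrainVorticityIsometry
import HarnessLib

/-!
# Miller's middle-eigenvalue bound `-det S ≤ ½|S|²λ₂⁺` and the criterion `dℰ/dt ≤ -ν‖Δu‖₂² + 2‖λ₂⁺‖_∞ ℰ` on `T³` — PROVED

Analysis/FluidPDE proof file (theorems only: no definitions, no named facts), sequel of
`MillerStrainDeterminantBound.lean` and `TorusStrainVorticityIsometry.lean`.

Miller, *A regularity criterion for the Navier–Stokes equation involving only the middle
eigenvalue of the strain tensor*, Arch. Ration. Mech. Anal. 235 (2020) 99–139 = arXiv:1710.05569: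

* **Lemma 5.1 (Middle eigenvalue determinant bound).** "`-det(S) ≤ ½|S|²λ₂⁺`", `λ₁ ≤ λ₂ ≤ λ₃` the
  eigenvalues of the symmetric trace-free `S`, `λ₂⁺ = max{λ₂, 0}` (proof: `λ₁ ≤ 0 ≤ λ₃`,
  `-det S = (-λ₁λ₃)λ₂ ≤ (-λ₁λ₃)λ₂⁺`, `-λ₁λ₃ ≤ ½(λ₁² + λ₃²) ≤ ½|S|²`). Here for any real symmetric
  trace-free matrix over an index type of cardinality `3`, the middle eigenvalue being Mathlib's
  SORTED eigenvalue `eigenvalues₀ 1` (`Matrix.IsHermitian.eigenvalues₀` is antitone: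
  `eigenvalues₀ 0 ≥ eigenvalues₀ 1 ≥ eigenvalues₀ 2`).
* **Lemma 5.1, integrated / Theorem 1.1, case `q = ∞`** ("`∂ₜ‖S‖²₂ ≤ 2‖λ₂⁺‖_{L^∞}‖S‖²₂`", then
  Grönwall: "`‖S(T)‖²₂ ≤ ‖S⁰‖²₂ exp(2∫₀ᵀ‖λ₂⁺‖_∞)`", printed for mild `Ḣ¹` solutions on `ℝ³`; the
  `q = ∞` case is due to Chae 2006, as Miller notes, p. 7). Here the periodic classical form: along a
  classical solution of the unforced Navier–Stokes equations on `T^d × [a, b]`, `card d = 3`, `a < b`,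
  any `ν` (Euler included): if the middle eigenvalue of the strain `S(t, x)` is `≤ Λ` for all `x`
  (`0 ≤ Λ`), every one-sided derivative `R` of `ℰ(s) = torusEnstrophy (u s) = ‖S(s)‖₂²` within
  `[a, b]` at `t` satisfies `R ≤ -ν‖Δu(t)‖₂² + 2Λ ℰ(t)`; and, for `ν ≥ 0` and a continuous majorant
  `Λ(s) ≥ 0` on `[a, b]`, `ℰ(u t) ≤ ℰ(u a) exp(2∫ₐᵗ Λ)`.

Ingredients: `dℰ/dt = -ν‖Δu‖₂² - 4∫det S` (`TorusEnstrophyStrainIdentity`), `∫|S|² = ℰ`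
(`TorusStrainVorticityIsometry`), `det S = ⅓ tr S³` pointwise (trace-free; for integrability), the
tree's Grönwall lemma `le_mul_exp_integral_of_hasDerivWithinAt_le_mul`.

These serve the functional-mining cell (pub-nsfunc; DICTIONARY §6 C3 `‖λ₂⁺‖_∞`, CRITERIA A10):
the `q = ∞` endpoint of the middle-eigenvalue criterion is now a kernel theorem in the torus setting
of the census (the `3/2 < q < ∞` range stays the named fact `Miller2019.middleEigenvalueCriterion`,
which needs Sobolev interpolation on `ℝ³`).

## Mathlib / tree search

Mathlib: `Matrix.IsHermitian.eigenvalues₀`, `eigenvalues₀_antitone`, `det_eq_prod_eigenvalues`,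
`trace_eq_sum_eigenvalues`, `Fin.cast_le_cast`, `finCongr`; tree:
`GurskyLeBrun.sum_sq_eq_sum_eigenvalues_sq`, `integral_stretching_eq_four_mul_integral_det_strain`,
`Torus.IsClassicalNSSolutionOn.hasDerivWithinAt_torusEnstrophy_det`,
`integral_strainNormSq_eq_torusEnstrophy`, `le_mul_exp_integral_of_hasDerivWithinAt_le_mul`.

## References

* E. Miller, Arch. Ration. Mech. Anal. 235 (2020) 99–139 = arXiv:1710.05569, Lemma 5.1 and
  Thm. 1.1 (proof, case `q = +∞`), held text p. 16. [Miller2019]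
* D. Chae, Commun. Math. Phys. 263 (2006) 789–801 ("On the spectral dynamics of the deformation
  tensor…"), Thm. — the `q = ∞` case (as attributed by Miller, p. 7); cite-only.
-/

noncomputable section

open Set MeasureTheory Finset Matrix
open scoped InnerProductSpace RealInnerProductSpace

namespace Literature.Analysis.FluidPDE

open Literature.Analysis.FunctionSpaces

namespace Miller2019

/-- Eigenvalue form of Lemma 5.1: for `a ≥ b ≥ c` with `a + b + c = 0`,
`-(abc) ≤ ½(a² + b² + c²) · max(b, 0)`. [cite: Miller2019, Lemma 5.1 (proof)] -/
theorem neg_prod_le_half_sumSq_mul_posPart_middle {a b c : ℝ} (hab : b ≤ a) (hbc : c ≤ b)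
    (h : a + b + c = 0) :
    -(a * b * c) ≤ 2⁻¹ * (a ^ 2 + b ^ 2 + c ^ 2) * max b 0 := by
  have ha : 0 ≤ a := by linarith
  have hc : c ≤ 0 := by linarith
  have hac2 : -(a * c) ≤ 2⁻¹ * (a ^ 2 + b ^ 2 + c ^ 2) := by
    nlinarith [sq_nonneg (a + c), sq_nonneg b]
  rcases le_or_gt 0 b with hb | hb
  · rw [max_eq_left hb]
    have : -(a * b * c) = -(a * c) * b := by ring
    rw [this]
    exact mul_le_mul_of_nonneg_right hac2 hb
  · rw [max_eq_right hb.le, mul_zero]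
    nlinarith [mul_nonneg ha (mul_nonneg_of_nonpos_of_nonpos hb.le hc)]

/-- **Miller's middle-eigenvalue determinant bound** (Lemma 5.1): for a real symmetric trace-free
matrix `M` over an index type of cardinality `3`, `-det M ≤ ½ |M|² λ₂⁺`, where `|M|² = ∑ᵢⱼ Mᵢⱼ²`
and `λ₂ = eigenvalues₀ 1` is the middle one of Mathlib's decreasingly sorted eigenvalues
(`λ₂⁺ = max(λ₂, 0)`). [cite: Miller2019, Lemma 5.1] -/
theorem neg_det_le_half_normSq_mul_posPart_middleEigenvalue {n : Type*} [Fintype n] [DecidableEq n]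
    (hn : Fintype.card n = 3) (M : Matrix n n ℝ) (hsym : M.IsSymm) (htr : M.trace = 0) :
    -M.det ≤ 2⁻¹ * (∑ i, ∑ j, M i j ^ 2) *
      max ((Matrix.isHermitian_iff_isSymm.mpr hsym).eigenvalues₀ (Fin.cast hn.symm 1)) 0 := by
  set hH : M.IsHermitian := Matrix.isHermitian_iff_isSymm.mpr hsym with hHdef
  set lam : Fin 3 → ℝ := fun a => hH.eigenvalues₀ (Fin.cast hn.symm a) with hlam
  have hE : ∀ f : ℝ → ℝ, ∑ i, f (hH.eigenvalues i) = ∑ a : Fin 3, f (lam a) := by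
    intro f
    have h1 : ∑ i, f (hH.eigenvalues i) = ∑ k, f (hH.eigenvalues₀ k) :=
      Fintype.sum_equiv (Fintype.equivOfCardEq (Fintype.card_fin _)).symm _ _ (fun i => rfl)
    rw [h1]
    exact Fintype.sum_equiv (finCongr hn) _ _ (fun k => by simp [hlam, finCongr])
  have hP : ∏ i, hH.eigenvalues i = ∏ a : Fin 3, lam a := by
    have h1 : ∏ i, hH.eigenvalues i = ∏ k, hH.eigenvalues₀ k :=
      Fintype.prod_equiv (Fintype.equivOfCardEq (Fintype.card_fin _)).symm _ _ (fun i => rfl)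
    rw [h1]
    exact Fintype.prod_equiv (finCongr hn) _ _ (fun k => by simp [hlam, finCongr])
  have hdet : M.det = ∏ a : Fin 3, lam a := by
    have := hH.det_eq_prod_eigenvalues
    simp only [RCLike.ofReal_real_eq_id, id_eq] at this
    rw [this, hP]
  have htr' : ∑ a : Fin 3, lam a = 0 := by
    have := hH.trace_eq_sum_eigenvalues
    simp only [RCLike.ofReal_real_eq_id, id_eq] at this
    rw [← hE (fun x => x), ← this, htr]
  have hfro : ∑ i, ∑ j, M i j ^ 2 = ∑ a : Fin 3, lam a ^ 2 := by
    rw [Literature.Geometry.Riemannian.GurskyLeBrun.sum_sq_eq_sum_eigenvalues_sq hsym]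
    exact hE (fun x => x ^ 2)
  have hanti : Antitone lam := fun a b hab =>
    hH.eigenvalues₀_antitone ((Fin.cast_le_cast hn.symm).mpr hab)
  rw [hdet, hfro]
  simp only [Fin.sum_univ_three, Fin.prod_univ_three] at htr' ⊢
  have h10 : lam 1 ≤ lam 0 := hanti (by decide)
  have h21 : lam 2 ≤ lam 1 := hanti (by decide)
  have key := neg_prod_le_half_sumSq_mul_posPart_middle h10 h21 htr'
  simpa [hlam] using key

end Miller2019

variable {d : Type*} [Fintype d] [DecidableEq d]

/-- **`det S = ⅓ tr S³` pointwise** for the strain of a `C¹` divergence-free field on `T^d`,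
`card d = 3` (`tr S = div u = 0`; Miller, §4: `tr(S³) = 3λ₁λ₂λ₃ = 3 det S`).
[cite: Miller2019, §4 (identity tr S³ = 3 det S)] -/
theorem det_strain_eq_third_sum_strain_cube (hd : Fintype.card d = 3)
    {u : UnitAddTorus d → EuclideanSpace ℝ d} (hu : Torus.IsSmooth u) (hdiv : Torus.IsDivFree u)
    (x : UnitAddTorus d) :
    Matrix.det (Matrix.of fun i j => (Torus.partialDeriv j u x i + Torus.partialDeriv i u x j) / 2) =
      (1 / 3) * ∑ i, ∑ j, ∑ k,
        ((Torus.partialDeriv j u x i + Torus.partialDeriv i u x j) / 2) *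
        ((Torus.partialDeriv k u x j + Torus.partialDeriv j u x k) / 2) *
        ((Torus.partialDeriv i u x k + Torus.partialDeriv k u x i) / 2) := by
  set e : d ≃ Fin 3 := Fintype.equivFinOfCardEq hd with he
  set Sd : Matrix d d ℝ := Matrix.of fun i j =>
    (Torus.partialDeriv j u x i + Torus.partialDeriv i u x j) / 2 with hSd
  set S3 : Fin 3 → Fin 3 → ℝ := fun a b => Sd (e.symm a) (e.symm b) with hS3
  have hre : ∀ G : d → ℝ, ∑ i, G i = ∑ a : Fin 3, G (e.symm a) := fun G =>
    Fintype.sum_equiv e _ _ fun i => by simp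
  have hdet : Sd.det = Matrix.det (Matrix.of fun a b => S3 a b) := by
    rw [← Matrix.det_reindex_self e Sd]
    rfl
  have hsym : ∀ a b, S3 a b = S3 b a := by
    intro a b; simp only [hS3, hSd, Matrix.of_apply]; ring
  have htr : ∑ a, S3 a a = 0 := by
    have h1 : ∑ a, S3 a a = ∑ m, Torus.partialDeriv m u x m := by
      simp only [hS3, hSd, Matrix.of_apply]
      rw [hre]
      exact Finset.sum_congr rfl fun a _ => by ring
    rw [h1, ← Torus.divergence_eq_sum_partialDeriv_apply (hu.isContDiff (by simp)) x]
    exact hdiv x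
  have hT : (∑ i, ∑ j, ∑ k,
      ((Torus.partialDeriv j u x i + Torus.partialDeriv i u x j) / 2) *
      ((Torus.partialDeriv k u x j + Torus.partialDeriv j u x k) / 2) *
      ((Torus.partialDeriv i u x k + Torus.partialDeriv k u x i) / 2)) =
      ∑ a, ∑ b, ∑ c, S3 a b * S3 b c * S3 c a := by
    simp only [hS3, hSd, Matrix.of_apply]
    simp_rw [hre]
  have hSd' : Matrix.det (Matrix.of fun i j =>
      (Torus.partialDeriv j u x i + Torus.partialDeriv i u x j) / 2) = Sd.det := rfl
  rw [hSd', hT, DoeringGibbon1995.trace_strain_cube_eq_three_mul_det S3 hsym htr, ← hdet]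
  ring

/-- The strain determinant of a smooth divergence-free field on `T^d`, `card d = 3`, is integrable
(it is `⅓ tr S³`, a polynomial in the smooth entries). [folklore] -/
private theorem integrable_det_strain (hd : Fintype.card d = 3)
    {u : UnitAddTorus d → EuclideanSpace ℝ d} (hu : Torus.IsSmooth u) (hdiv : Torus.IsDivFree u) :
    Integrable (fun x => Matrix.det (Matrix.of fun i j =>
      (Torus.partialDeriv j u x i + Torus.partialDeriv i u x j) / 2)) volume := by
  have hD : ∀ m, Torus.IsSmooth (Torus.partialDeriv m u) := fun m => hu.partialDeriv m
  have hDc : ∀ m j, Torus.IsSmooth (fun y => Torus.partialDeriv m u y j) :=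
    fun m j => (hD m).apply j
  have hSc : ∀ i j, Torus.IsSmooth (fun x => (Torus.partialDeriv j u x i +
      Torus.partialDeriv i u x j) / 2) := fun i j => ((hDc j i).add (hDc i j)).div_const 2
  have hTs : Torus.IsSmooth (fun x => ∑ i, ∑ j, ∑ k,
      ((Torus.partialDeriv j u x i + Torus.partialDeriv i u x j) / 2) *
      ((Torus.partialDeriv k u x j + Torus.partialDeriv j u x k) / 2) *
      ((Torus.partialDeriv i u x k + Torus.partialDeriv k u x i) / 2)) := by
    have h : ∀ i j k, Torus.IsSmooth (fun x =>
        ((Torus.partialDeriv j u x i + Torus.partialDeriv i u x j) / 2) *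
        ((Torus.partialDeriv k u x j + Torus.partialDeriv j u x k) / 2) *
        ((Torus.partialDeriv i u x k + Torus.partialDeriv k u x i) / 2)) :=
      fun i j k => ((hSc i j).mul (hSc j k)).mul (hSc k i)
    unfold Torus.IsSmooth at h ⊢
    exact ContDiff.sum fun i _ => ContDiff.sum fun j _ => ContDiff.sum fun k _ => h i j k
  exact (hTs.integrable.const_mul (1 / 3 : ℝ)).congr
    (Filter.Eventually.of_forall fun x => (det_strain_eq_third_sum_strain_cube hd hu hdiv x).symm)

/-- **`dℰ/dt ≤ -ν‖Δu‖₂² + 2‖λ₂⁺‖_∞ ℰ`** (Miller, Lemma 5.1 integrated with Hölder `(1, ∞)` = the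
`q = ∞` case of Thm. 1.1; periodic classical form): along a classical solution of the unforced
Navier–Stokes equations on `T^d × [a, b]`, `card d = 3`, `a < b` (any `ν`), if at time `t ∈ [a, b]`
the middle eigenvalue of the strain `S(t, x) = Matrix.of fun i j => ½((∂ⱼu)ᵢ + (∂ᵢu)ⱼ)` is
`≤ Λ` for every `x` (`0 ≤ Λ`; the hypothesis is stated for every proof `hx` that `S(t,x)` is Hermitian —
all give the same `eigenvalues₀`), then every one-sided derivative `R` of `s ↦ ℰ(u s)` within
`[a, b]` at `t` satisfies `R ≤ -ν‖Δu(t)‖₂² + 2Λ ℰ(u t)` (`ℰ = torusEnstrophy = ‖S‖₂²`).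
[cite: Miller2019, Lemma 5.1 and Thm. 1.1 (case q = ∞)] -/
theorem _root_.Literature.Analysis.FunctionSpaces.Torus.IsClassicalNSSolutionOn.enstrophyRate_le_middleEigenvalue_sup
    (hd : Fintype.card d = 3) {a b ν : ℝ} {u : ℝ → UnitAddTorus d → EuclideanSpace ℝ d}
    {p : ℝ → UnitAddTorus d → ℝ} (h : Torus.IsClassicalNSSolutionOn (Icc a b) ν 0 u p)
    (hab : a < b) {t : ℝ} (ht : t ∈ Icc a b) {Λ : ℝ} (hΛ0 : 0 ≤ Λ)
    (hΛ : ∀ x, ∀ hx : (Matrix.of fun i j =>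
        (Torus.partialDeriv j (u t) x i + Torus.partialDeriv i (u t) x j) / 2).IsHermitian,
        hx.eigenvalues₀ (Fin.cast hd.symm 1) ≤ Λ)
    (R : ℝ) (hR : HasDerivWithinAt (fun s => torusEnstrophy (u s)) R (Icc a b) t) :
    R ≤ -ν * (∫ x, ‖Torus.laplacian (u t) x‖ ^ 2) + 2 * Λ * torusEnstrophy (u t) := by
  have hut : Torus.IsSmooth (u t) := h.smooth_velocity.isSmooth_slice ht
  have hdivt : Torus.IsDivFree (u t) := h.divFree t ht
  have hU : UniqueDiffWithinAt ℝ (Icc a b) t := uniqueDiffOn_Icc hab t ht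
  have hbal := h.hasDerivWithinAt_torusEnstrophy_det hd hab ht
  have hReq : R = -ν * (∫ x, ‖Torus.laplacian (u t) x‖ ^ 2) -
      4 * ∫ x, Matrix.det (Matrix.of fun i j =>
        (Torus.partialDeriv j (u t) x i + Torus.partialDeriv i (u t) x j) / 2) :=
    (hR.derivWithin hU).symm.trans (hbal.derivWithin hU)
  -- the strain matrix field, its Frobenius square, pointwise Lemma 5.1
  set Sd : UnitAddTorus d → Matrix d d ℝ := fun x => Matrix.of fun i j =>
    (Torus.partialDeriv j (u t) x i + Torus.partialDeriv i (u t) x j) / 2 with hSd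
  set F : UnitAddTorus d → ℝ := fun x => ∑ i, ∑ j,
    ((Torus.partialDeriv j (u t) x i + Torus.partialDeriv i (u t) x j) / 2) ^ 2 with hF
  have hF0 : ∀ x, 0 ≤ F x := fun x =>
    Finset.sum_nonneg fun i _ => Finset.sum_nonneg fun j _ => sq_nonneg _
  have hpt : ∀ x, -4 * (Sd x).det ≤ 2 * Λ * F x := by
    intro x
    have hsym : (Sd x).IsSymm := by
      refine Matrix.IsSymm.ext fun i j => ?_
      simp only [hSd, Matrix.of_apply]; ring
    have htr : (Sd x).trace = 0 := by
      simp only [Matrix.trace, Matrix.diag, hSd, Matrix.of_apply]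
      have h1 : ∑ i, (Torus.partialDeriv i (u t) x i + Torus.partialDeriv i (u t) x i) / 2 =
          ∑ i, Torus.partialDeriv i (u t) x i := Finset.sum_congr rfl fun i _ => by ring
      rw [h1, ← Torus.divergence_eq_sum_partialDeriv_apply (hut.isContDiff (by simp)) x]
      exact hdivt x
    have h51 := Miller2019.neg_det_le_half_normSq_mul_posPart_middleEigenvalue hd (Sd x) hsym htr
    have hmax : max ((Matrix.isHermitian_iff_isSymm.mpr hsym).eigenvalues₀ (Fin.cast hd.symm 1)) 0
        ≤ Λ := max_le (hΛ x _) hΛ0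
    have hFx : ∑ i, ∑ j, Sd x i j ^ 2 = F x := by simp only [hSd, hF, Matrix.of_apply]
    rw [hFx] at h51
    have h2 : 2⁻¹ * F x * max ((Matrix.isHermitian_iff_isSymm.mpr hsym).eigenvalues₀
        (Fin.cast hd.symm 1)) 0 ≤ 2⁻¹ * F x * Λ :=
      mul_le_mul_of_nonneg_left hmax (by positivity)
    linarith
  -- integrate
  have hFs : Torus.IsSmooth F := by
    have hD : ∀ m, Torus.IsSmooth (Torus.partialDeriv m (u t)) := fun m => hut.partialDeriv m
    have hDc : ∀ m j, Torus.IsSmooth (fun y => Torus.partialDeriv m (u t) y j) :=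
      fun m j => (hD m).apply j
    have hh : ∀ i j, Torus.IsSmooth (fun x =>
        ((Torus.partialDeriv j (u t) x i + Torus.partialDeriv i (u t) x j) / 2) ^ 2) :=
      fun i j => (((hDc j i).add (hDc i j)).div_const 2).pow 2
    unfold Torus.IsSmooth at hh ⊢
    exact ContDiff.sum fun i _ => ContDiff.sum fun j _ => hh i j
  have hdetI : Integrable (fun x => (Sd x).det) volume := integrable_det_strain hd hut hdivt
  have hmono : ∫ x, -4 * (Sd x).det ≤ ∫ x, 2 * Λ * F x :=
    integral_mono (hdetI.const_mul _) (hFs.integrable.const_mul _) hpt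
  rw [integral_const_mul, integral_const_mul] at hmono
  have hFint : ∫ x, F x = torusEnstrophy (u t) := integral_strainNormSq_eq_torusEnstrophy hut hdivt
  rw [hFint] at hmono
  have hSd' : (∫ x, Matrix.det (Matrix.of fun i j =>
      (Torus.partialDeriv j (u t) x i + Torus.partialDeriv i (u t) x j) / 2)) = ∫ x, (Sd x).det := rfl
  rw [hReq, hSd']
  linarith

/-- **Grönwall form — Miller's Theorem 1.1 at `q = ∞`, periodic classical version**
(`‖S(T)‖²₂ ≤ ‖S⁰‖²₂ exp(2∫‖λ₂⁺‖_∞)`): along a classical solution of the unforced Navier–Stokes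
equations with `ν ≥ 0` (Euler included) on `T^d × [a, b]`, `card d = 3`, `a < b`, if `Λ : ℝ → ℝ` is
continuous and nonnegative on `[a, b]` and bounds the middle eigenvalue of the strain `S(s, x)` for
all `s ∈ [a, b]` and all `x`, then `ℰ(u t) ≤ ℰ(u a) · exp(2∫ₐᵗ Λ)` for every `t ∈ [a, b]`. In
particular a finite `∫‖λ₂⁺‖_∞` keeps the enstrophy bounded (no blow-up of `ℰ` before `b`).
[cite: Miller2019, Thm. 1.1 (case q = ∞)] -/
theorem torusEnstrophy_le_mul_exp_integral_middleEigenvalueBound (hd : Fintype.card d = 3)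
    {ν a b : ℝ} (hν : 0 ≤ ν) (hab : a < b)
    {u : ℝ → UnitAddTorus d → EuclideanSpace ℝ d} {p : ℝ → UnitAddTorus d → ℝ}
    (h : Torus.IsClassicalNSSolutionOn (Icc a b) ν 0 u p)
    {Λ : ℝ → ℝ} (hΛc : ContinuousOn Λ (Icc a b)) (hΛ0 : ∀ s ∈ Icc a b, 0 ≤ Λ s)
    (hΛ : ∀ s ∈ Icc a b, ∀ x, ∀ hx : (Matrix.of fun i j =>
        (Torus.partialDeriv j (u s) x i + Torus.partialDeriv i (u s) x j) / 2).IsHermitian,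
        hx.eigenvalues₀ (Fin.cast hd.symm 1) ≤ Λ s)
    {t : ℝ} (ht : t ∈ Icc a b) :
    torusEnstrophy (u t) ≤ torusEnstrophy (u a) * Real.exp (2 * ∫ s in a..t, Λ s) := by
  set G : ℝ → ℝ := fun s => -ν * (∫ x, ‖Torus.laplacian (u s) x‖ ^ 2) +
      ∫ x, ⟪Torus.convect (u s) (u s) x - (0 : ℝ → UnitAddTorus d → EuclideanSpace ℝ d) s x,
        Torus.laplacian (u s) x⟫_ℝ with hG
  have hder : ∀ s ∈ Icc a b,
      HasDerivWithinAt (fun r => torusEnstrophy (u r)) (G s) (Icc a b) s :=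
    fun s hs => h.hasDerivWithinAt_half_gradNormSq hab hs
  have hle : ∀ s ∈ Icc a b, G s ≤ (2 * Λ s) * torusEnstrophy (u s) := by
    intro s hs
    have h1 := h.enstrophyRate_le_middleEigenvalue_sup hd hab hs (hΛ0 s hs) (hΛ s hs) (G s) (hder s hs)
    have hdiss : 0 ≤ ν * ∫ x, ‖Torus.laplacian (u s) x‖ ^ 2 :=
      mul_nonneg hν (integral_nonneg fun x => sq_nonneg _)
    linarith
  have hk : ContinuousOn (fun s => 2 * Λ s) (Icc a b) := continuousOn_const.mul hΛc
  have hmain := le_mul_exp_integral_of_hasDerivWithinAt_le_mul hab hder hk hle ht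
  rwa [intervalIntegral.integral_const_mul] at hmain

end Literature.Analysis.FluidPDE
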